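import Summits.SmoothPoincare4.SmoothPoincare4.Theses.RicciFat
import Summits.SmoothPoincare4.SmoothPoincare4.Theorems.EntropyRungSubcylindricalExistenceTransport
import HarnessLib

/-!
# The Weyl-gap threshold split of route RicciFat's crux `RicciFatSphere` (stmt-SmoothPoincare4-5192):
  the assembly `RecognitionBeyondWeylGap → FatBeyondWeylGap → RicciFatSphere`

BC2 redirect of the summit-equivalent deciding crux `RicciFat.RicciFatSphere` ("every closed smooth
homotopy 4-sphere carries, for every `δ > 0`, a `C^∞` metric with `Ric ≥ 3` and
`Vol ≥ (1 − δ)·8π²/3`"; `RicciFatSphere ↔ SmoothPoincare4` modulo Cheeger–Colding, tree theorem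
`ricciFatSphere_iff_spc4`) into an EXISTENCE half and a RECOGNITION half at the volume threshold
`8π²/9 = Vol(S⁴)/3` — the threshold singled out by the Gursky–LeBrun Weyl-curvature gap for Einstein
4-manifolds (`∫|W^±|² ≥ ∫ R²/24` unless `W^± ≡ 0`; with Chern–Gauss–Bonnet and Hitchin's
classification of half-conformally-flat Einstein manifolds, an Einstein metric `Ric = 3g` on a homotopy
4-sphere with `Vol > 8π²/9` is round):

* `F` = FAT BEYOND THE WEYL GAP: every closed smooth `M ≃ₕ S⁴` carries a `C^∞` Riemannian metric `h`
  (with its Levi-Civita connection) with `Ric_h ≥ 3h` and `Vol(M, h) > 8π²/9`;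
* `R` = RECOGNITION BEYOND THE WEYL GAP ("`δ₄ ≥ 2/3` on homotopy 4-spheres"): a closed smooth
  `M ≃ₕ S⁴` carrying such a metric is diffeomorphic to `S⁴`.

This file (the Theorems copy of the strategist workfile `Cruxes/RicciFatSphere/Lines/WeylGapSplit.lean`,
landed so that the split can be recorded with `route edit --split … --glue-by`) proves the assembly
`R → F → RicciFatSphere` over the two route items `RicciFat.RecognitionBeyondWeylGap`,
`RicciFat.FatBeyondWeylGap` by name: fix `M ≃ₕ S⁴` and `δ > 0`; `F` gives a fat metric, `R` a diffeomorphism `Φ : M ≃ₘ S⁴`,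
and the round metric pulled back along `Φ` has `Ric = 3g` and `Vol = 8π²/3 ≥ (1 − δ)·8π²/3`
(`exists_roundMetric_transport`: naturality of the Ricci tensor, invariance of the Riemannian measure
under isometric diffeomorphisms — the per-`M` form of the proved support item stmt-SmoothPoincare4-5193).
Everything is proved (no `sorry`, no definition, no named fact).

References: [GurskyLeBrun1999] M. Gursky, C. LeBrun, *On Einstein manifolds of positive sectional
curvature*, Ann. Global Anal. Geom. 17 (1999) 315–328 (the gap `∫|W^±|² ≥ ∫R²/24`, quoted in
arXiv:1903.11818 p. 4); [Hitchin1974] N. Hitchin, *Compact four-dimensional Einstein manifolds*,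
J. Differential Geom. 9 (1974) 435–441; [ONeill1983] Ch. 3, Prop. 3.59; [CheegerColding1997] (context).
-/

noncomputable section

-- the registered namespace `Summit.SmoothPoincare4.SmoothPoincare4.Theorems` repeats a component
set_option linter.dupNamespace false

open scoped Manifold ContDiff Topology ENNReal NNReal ContinuousMap
open Set MeasureTheory
open Literature.Geometry.Lorentzian Literature.Geometry.Riemannian

namespace Summit.SmoothPoincare4.SmoothPoincare4.Theorems

/-- **The Weyl-gap split of `RicciFatSphere` assembles**: RECOGNITION beyond the Weyl gap (a closed
smooth `M ≃ₕ S⁴` with a `C^∞` metric, `Ric ≥ 3`, `Vol > 8π²/9` is diffeomorphic to `S⁴`) and EXISTENCE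
beyond the Weyl gap (every closed smooth `M ≃ₕ S⁴` carries such a metric) imply route RicciFat's crux
`RicciFatSphere` — pull the round metric back along the diffeomorphism: `Ric = 3g`,
`Vol = 8π²/3 ≥ (1 − δ)·8π²/3` for every `δ > 0`. The hypotheses are the route items
`RicciFat.RecognitionBeyondWeylGap` and `RicciFat.FatBeyondWeylGap` BY NAME (the `_of_subs` shape
`Sub₁ → Sub₂ → RicciFatSphere` that `route edit --split … --glue-by` consumes). [folklore] -/
theorem ricciFatSphere_of_weylGap
    (hR : _root_.Summit.SmoothPoincare4.SmoothPoincare4.Theses.RicciFat.RecognitionBeyondWeylGap)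
    (hF : _root_.Summit.SmoothPoincare4.SmoothPoincare4.Theses.RicciFat.FatBeyondWeylGap) :
    _root_.Summit.SmoothPoincare4.SmoothPoincare4.Theses.RicciFat.RicciFatSphere := by
  intro M _ _ _ _ _ _ _ _ e δ hδ
  -- existence half: a fat metric on `M`; recognition half: hence `M ≅ S⁴`
  obtain ⟨h, hLC, hRic, hVol⟩ := hF M e
  obtain ⟨Φ⟩ := hR M e ⟨h, hLC, hRic, hVol⟩
  -- transport the round metric along `Φ` (compact + T₂ ⇒ T₃ feeds `riemannianMeasure`)
  obtain ⟨g, hLCg, hg, hRicg, hVolg⟩ := exists_roundMetric_transport Φ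
  -- the pseudo-Riemannian metric of the Mathlib Riemannian metric of `g` is `g` again
  have hback : PseudoRiemannianMetric.ofRiemannian (g.toContMDiffRiemannianMetric hg) = g := by
    ext; rfl
  haveI hLC' : (PseudoRiemannianMetric.ofRiemannian (g.toContMDiffRiemannianMetric hg)).HasLeviCivita :=
    (PseudoRiemannianMetric.ofRiemannian _).hasLeviCivita
  -- `Ric ≥ 3g` passes along the equality of metrics (the Levi-Civita instance is a `Prop`)
  have hRic' : ∀ (g' : PseudoRiemannianMetric (𝓡 4) ∞ (EuclideanSpace ℝ (Fin 4))
      (TangentSpace (𝓡 4) : M → Type _)) [g'.HasLeviCivita], g' = g →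
      ∀ (x : M) (v : TangentSpace (𝓡 4) x), 3 * g'.val x v v ≤ g'.ricci x v v := by
    rintro g' _ rfl x v
    exact (hRicg x v v).symm.le
  refine ⟨g.toContMDiffRiemannianMetric hg, hLC', fun x v ↦ hRic' _ hback x v, ?_⟩
  -- `Vol = 8π²/3 ≥ (1 − δ)·8π²/3`
  rw [hVolg]
  exact ENNReal.ofReal_le_ofReal (by nlinarith [Real.pi_pos, sq_nonneg Real.pi])

/-- **Route item `RicciFat.RicciFatSphereOfWeylGap` (stmt-SmoothPoincare4-18050), by name**: the split
glue `RecognitionBeyondWeylGap → FatBeyondWeylGap → RicciFatSphere` is `ricciFatSphere_of_weylGap`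
(same statement, the item's own decl name). [folklore] -/
theorem ricciFatSphereOfWeylGap_proof :
    _root_.Summit.SmoothPoincare4.SmoothPoincare4.Theses.RicciFat.RicciFatSphereOfWeylGap :=
  fun hR hF ↦ ricciFatSphere_of_weylGap hR hF

end Summit.SmoothPoincare4.SmoothPoincare4.Theorems

end
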